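import Literature.AlgebraicGeometry.DeterminantalHypersurfaces.KernerVinnikovSaturation
import Literature.AlgebraicGeometry.DeterminantalHypersurfaces.KernerVinnikovBlocks
import Mathlib.RingTheory.Coprime.Lemmas
import Mathlib.Algebra.MvPolynomial.Nilpotent
import HarnessLib

/-!
# Kerner–Vinnikov decomposability: Part 2 of the proof of Thm. 3.1 (proofs)

D. Kerner, V. Vinnikov, *Determinantal representations of singular hypersurfaces in ℙⁿ*,
Adv. Math. 231 (2012), arXiv:0906.3012, §3, proof of Thm. 3.1, **Part 2**, formalised verbatim:
from `adj M = f₂ N₁ + f₁ N₂` (output of Part 1) one gets `M N_α = f_α A_α`, `N_α M = f_α B_α`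
with CONSTANT matrices `A_α, B_α` (degree count), `A₁ + A₂ = 𝟙 = B₁ + B₂`,
`B_β N_α = 0 = N_β A_α` (`α ≠ β`; coprimality and `deg N_α = d_α - 1 < d_α`), hence
`A_α A_β = 0 = B_β B_α`: complementary idempotents, which constant changes of bases bring to
`𝟙 ⊕ 0`, `0 ⊕ 𝟙`; then `M` is block diagonal and `det M_α = c_α f_α` ("the multiplicities are
determined uniquely").  Two points left implicit in the printed proof are made explicit: the ranks
of `A₁` and `B₁` agree because `f₁ tr A₁ = tr(M N₁) = tr(N₁ M) = f₁ tr B₁` (trace = rank for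
idempotents, `char k = 0`), and the block sizes are `deg f_α` by comparing degrees of
`det M_α = c_α f_α`.

Main result: `exists_blockDecomposition_of_adjugate_mem_span_pair`.
-/

noncomputable section

open MvPolynomial Matrix

namespace Literature.AlgebraicGeometry.DeterminantalHypersurfaces

section helpers

variable {σ : Type*} {k : Type*} [Field k]

/-- Entries of a product of matrices of forms of degrees `a` and `b` are forms of degree `a + b`.
[folklore] -/
theorem isHomogeneous_mul_apply {ι κ μ : Type*} [Fintype κ] {X : Matrix ι κ (MvPolynomial σ k)}
    {Y : Matrix κ μ (MvPolynomial σ k)} {a b : ℕ} (hX : ∀ i j, (X i j).IsHomogeneous a)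
    (hY : ∀ i j, (Y i j).IsHomogeneous b) (i : ι) (j : μ) : ((X * Y) i j).IsHomogeneous (a + b) := by
  rw [Matrix.mul_apply]
  exact IsHomogeneous.sum _ _ _ fun l _ => (hX i l).mul (hY l j)

/-- Entries of a constant matrix (mapped by `C`) are forms of degree `0`. [folklore] -/
theorem isHomogeneous_map_C_apply {ι κ : Type*} (A : Matrix ι κ k) (i : ι) (j : κ) :
    ((A.map C : Matrix ι κ (MvPolynomial σ k)) i j).IsHomogeneous 0 := by
  rw [Matrix.map_apply]
  exact isHomogeneous_C σ _

/-- A matrix of forms of degree `p`, all divisible by a nonzero form `f` of degree `p`, is `f` times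
a constant matrix. [folklore] -/
theorem exists_eq_smul_map_C {ι κ : Type*} {Z : Matrix ι κ (MvPolynomial σ k)}
    {f : MvPolynomial σ k} {p : ℕ} (hf : f.IsHomogeneous p) (hf0 : f ≠ 0)
    (hZ : ∀ i j, (Z i j).IsHomogeneous p) (hdvd : ∀ i j, f ∣ Z i j) :
    ∃ A : Matrix ι κ k, Z = f • (A.map C : Matrix ι κ (MvPolynomial σ k)) := by
  choose a ha using hdvd
  refine ⟨Matrix.of fun i j => coeff 0 (a i j), Matrix.ext fun i j => ?_⟩
  rw [Matrix.smul_apply, Matrix.map_apply, Matrix.of_apply, smul_eq_mul]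
  have h1 : (f * a i j).IsHomogeneous p := ha i j ▸ hZ i j
  rw [ha i j, ← eq_C_of_isHomogeneous_mul_self hf hf0 h1]

/-- Cancellation of a nonzero scalar polynomial on matrices. [folklore] -/
theorem smul_cancel_of_ne_zero {ι κ : Type*} {f : MvPolynomial σ k} (hf0 : f ≠ 0)
    {X Y : Matrix ι κ (MvPolynomial σ k)} (h : f • X = f • Y) : X = Y := by
  refine Matrix.ext fun i j => ?_
  have := congrFun (congrFun h i) j
  simp only [Matrix.smul_apply, smul_eq_mul] at this
  exact mul_left_cancel₀ hf0 this

/-- `A ↦ A.map C` is injective on matrices. [folklore] -/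
theorem map_C_injective {ι κ : Type*} :
    Function.Injective (fun A : Matrix ι κ k => (A.map C : Matrix ι κ (MvPolynomial σ k))) :=
  Matrix.map_injective (C_injective σ k)

/-- The coprimality/degree step of Part 2 of [KernerVinnikov2012, Thm. 3.1]: from
`M N_α = f_α A_α`, `N_β M = f_β B_β` (`A_α, B_β` constant), `f_α, f_β` coprime, `f_α ≠ 0` of degree
`d_α` and `N_α` of degree `d_α - 1 < d_α` one gets `B_β N_α = 0 = N_β A_α`.
[cite: KernerVinnikov2012, §3, proof of Thm. 3.1, Part 2] -/
theorem offDiag_eq_zero {d dα : ℕ} (hdα : 0 < dα) {fα fβ : MvPolynomial σ k}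
    (hfα : fα.IsHomogeneous dα) (hfα0 : fα ≠ 0) (hcop : IsRelPrime fα fβ)
    {M Nα Nβ : Matrix (Fin d) (Fin d) (MvPolynomial σ k)} {Aα Bβ : Matrix (Fin d) (Fin d) k}
    (hNα : ∀ i j, (Nα i j).IsHomogeneous (dα - 1))
    (hMNα : M * Nα = fα • (Aα.map C : Matrix _ _ (MvPolynomial σ k)))
    (hNβM : Nβ * M = fβ • (Bβ.map C : Matrix _ _ (MvPolynomial σ k))) :
    (Bβ.map C : Matrix _ _ (MvPolynomial σ k)) * Nα = 0 ∧
      Nβ * (Aα.map C : Matrix _ _ (MvPolynomial σ k)) = 0 := by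
  have key : fα • (Nβ * (Aα.map C : Matrix _ _ (MvPolynomial σ k))) =
      fβ • ((Bβ.map C : Matrix _ _ (MvPolynomial σ k)) * Nα) := by
    rw [← Matrix.mul_smul, ← hMNα, ← Matrix.mul_assoc, hNβM, Matrix.smul_mul]
  have h1 : (Bβ.map C : Matrix _ _ (MvPolynomial σ k)) * Nα = 0 := by
    refine Matrix.ext fun i j => ?_
    have hy : (((Bβ.map C : Matrix _ _ (MvPolynomial σ k)) * Nα) i j).IsHomogeneous (dα - 1) := by
      have := isHomogeneous_mul_apply (isHomogeneous_map_C_apply Bβ) hNα i j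
      rwa [zero_add] at this
    have hdvd : fα ∣ ((Bβ.map C : Matrix _ _ (MvPolynomial σ k)) * Nα) i j := by
      refine hcop.dvd_of_dvd_mul_left ⟨(Nβ * (Aα.map C : Matrix _ _ (MvPolynomial σ k))) i j, ?_⟩
      have := congrFun (congrFun key i) j
      simp only [Matrix.smul_apply, smul_eq_mul] at this
      rw [this]
    rw [Matrix.zero_apply]
    exact eq_zero_of_dvd_of_isHomogeneous_lt hfα hfα0 hy (by omega) hdvd
  refine ⟨h1, ?_⟩
  rw [h1, smul_zero] at key
  refine Matrix.ext fun i j => ?_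
  have := congrFun (congrFun key i) j
  simp only [Matrix.smul_apply, smul_eq_mul, Matrix.zero_apply, mul_eq_zero] at this
  rw [Matrix.zero_apply]
  exact this.resolve_left hfα0

/-- Nonzero-ness of a form coprime to a form of positive degree. [folklore] -/
theorem ne_zero_of_isRelPrime_of_isHomogeneous {f g : MvPolynomial σ k} {e : ℕ} (he : 0 < e)
    (hg : g.IsHomogeneous e) (h : IsRelPrime f g) : f ≠ 0 := by
  rintro rfl
  have hu : IsUnit g := isRelPrime_zero_left.mp h
  obtain ⟨r, hr, rfl⟩ := (MvPolynomial.isUnit_iff_eq_C_of_isReduced (P := g)).mp hu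
  have h0 : (C r : MvPolynomial σ k).IsHomogeneous 0 := isHomogeneous_C σ r
  have := h0.inj_right hg (by simpa using hr.ne_zero)
  omega

/-- `tr (A.map C) = C (tr A)`. [folklore] -/
theorem trace_map_C {ι : Type*} [Fintype ι] (A : Matrix ι ι k) :
    (A.map C : Matrix ι ι (MvPolynomial σ k)).trace = C A.trace := by
  simp [Matrix.trace, map_sum]

end helpers

/-! ## Part 2 of the proof of [KernerVinnikov2012, Thm. 3.1] -/

section part2

variable {σ : Type*} {k : Type*} [Field k]

/-- The projector identities of Part 2 of [KernerVinnikov2012, Thm. 3.1]: from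
`adj M ∈ (f₁, f₂)` entrywise one constructs forms `N_α` of degree `d_α - 1` and CONSTANT matrices
`A_α, B_α` with `adj M = f₂ N₁ + f₁ N₂`, `M N_α = f_α A_α`, `N_α M = f_α B_α`, `A₁ + A₂ = 𝟙 = B₁ + B₂`,
`N_β A_α = 0 = B_β N_α` (`α ≠ β`) and `tr A₁ = tr B₁`.
[cite: KernerVinnikov2012, §3, proof of Thm. 3.1, Part 2] -/
theorem exists_projectors_of_adjugate_mem_span_pair {d d₁ d₂ : ℕ} (hd : d = d₁ + d₂)
    (hd₁ : 0 < d₁) (hd₂ : 0 < d₂) {f₁ f₂ : MvPolynomial σ k}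
    (h₁ : f₁.IsHomogeneous d₁) (h₂ : f₂.IsHomogeneous d₂) (hcop : IsRelPrime f₁ f₂)
    (M : Matrix (Fin d) (Fin d) (MvPolynomial σ k))
    (hM : ∀ i j, (M i j).IsHomogeneous 1) (hdet : M.det = f₁ * f₂)
    (hadj : ∀ i j, M.adjugate i j ∈ Ideal.span {f₁, f₂}) :
    ∃ (N₁ N₂ : Matrix (Fin d) (Fin d) (MvPolynomial σ k)) (A₁ A₂ B₁ B₂ : Matrix (Fin d) (Fin d) k),
      M * N₁ = f₁ • (A₁.map C : Matrix _ _ (MvPolynomial σ k)) ∧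
      M * N₂ = f₂ • (A₂.map C : Matrix _ _ (MvPolynomial σ k)) ∧
      N₁ * M = f₁ • (B₁.map C : Matrix _ _ (MvPolynomial σ k)) ∧
      N₂ * M = f₂ • (B₂.map C : Matrix _ _ (MvPolynomial σ k)) ∧
      A₁ + A₂ = 1 ∧ B₁ + B₂ = 1 ∧
      N₁ * (A₂.map C : Matrix _ _ (MvPolynomial σ k)) = 0 ∧
      N₂ * (A₁.map C : Matrix _ _ (MvPolynomial σ k)) = 0 ∧
      (B₂.map C : Matrix _ _ (MvPolynomial σ k)) * N₁ = 0 ∧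
      (B₁.map C : Matrix _ _ (MvPolynomial σ k)) * N₂ = 0 ∧
      A₁.trace = B₁.trace := by
  have hf₁0 : f₁ ≠ 0 := ne_zero_of_isRelPrime_of_isHomogeneous hd₂ h₂ hcop
  have hf₂0 : f₂ ≠ 0 := ne_zero_of_isRelPrime_of_isHomogeneous hd₁ h₁ hcop.symm
  have hf0 : f₁ * f₂ ≠ 0 := mul_ne_zero hf₁0 hf₂0
  -- `adj M = f₂ N₁ + f₁ N₂` with `N_α` homogeneous of degree `d_α - 1`
  obtain ⟨N₁, N₂, hN₁h, hN₂h, hadjN⟩ : ∃ N₁ N₂ : Matrix (Fin d) (Fin d) (MvPolynomial σ k),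
      (∀ i j, (N₁ i j).IsHomogeneous (d₁ - 1)) ∧ (∀ i j, (N₂ i j).IsHomogeneous (d₂ - 1)) ∧
      M.adjugate = f₂ • N₁ + f₁ • N₂ := by
    have hex := fun i j => Ideal.mem_span_pair.mp (hadj i j)
    choose a b hab using hex
    refine ⟨Matrix.of fun i j => homogeneousComponent (d₁ - 1) (b i j),
      Matrix.of fun i j => homogeneousComponent (d₂ - 1) (a i j),
      fun i j => homogeneousComponent_isHomogeneous _ _,
      fun i j => homogeneousComponent_isHomogeneous _ _, Matrix.ext fun i j => ?_⟩
    have hadjh : (M.adjugate i j).IsHomogeneous (d₁ + d₂ - 1) := by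
      have := isHomogeneous_adjugate_of_linear hM i j
      rw [Fintype.card_fin] at this
      have e : d - 1 = d₁ + d₂ - 1 := by omega
      exact e ▸ this
    have := congrArg (homogeneousComponent (d₁ + d₂ - 1)) (hab i j)
    rw [map_add, homogeneousComponent_eq_self hadjh,
      Resolution.homogeneousComponent_mul_of_isHomogeneous (a i j) f₁ _ h₁, if_pos (by omega),
      Resolution.homogeneousComponent_mul_of_isHomogeneous (b i j) f₂ _ h₂, if_pos (by omega),
      show d₁ + d₂ - 1 - d₁ = d₂ - 1 by omega, show d₁ + d₂ - 1 - d₂ = d₁ - 1 by omega] at this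
    rw [← this]
    simp only [Matrix.add_apply, Matrix.smul_apply, Matrix.of_apply, smul_eq_mul]
    ring
  have hMadj : M * M.adjugate = (f₁ * f₂) • (1 : Matrix _ _ (MvPolynomial σ k)) := by
    rw [mul_adjugate, hdet]
  have hadjM : M.adjugate * M = (f₁ * f₂) • (1 : Matrix _ _ (MvPolynomial σ k)) := by
    rw [adjugate_mul, hdet]
  -- entrywise consequences of `M adj M = f₁ f₂ = adj M M`
  have eMN : ∀ i j, f₂ * (M * N₁) i j + f₁ * (M * N₂) i j = f₁ * f₂ * (if i = j then 1 else 0) := by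
    intro i j
    have := congrFun (congrFun hMadj i) j
    rw [hadjN, Matrix.mul_add, Matrix.mul_smul, Matrix.mul_smul] at this
    simpa [Matrix.one_apply] using this
  have eNM : ∀ i j, f₂ * (N₁ * M) i j + f₁ * (N₂ * M) i j = f₁ * f₂ * (if i = j then 1 else 0) := by
    intro i j
    have := congrFun (congrFun hadjM i) j
    rw [hadjN, Matrix.add_mul, Matrix.smul_mul, Matrix.smul_mul] at this
    simpa [Matrix.one_apply] using this
  have hd₁' : 1 + (d₁ - 1) = d₁ := by omega
  have hd₂' : 1 + (d₂ - 1) = d₂ := by omega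
  have hd₁'' : d₁ - 1 + 1 = d₁ := by omega
  have hd₂'' : d₂ - 1 + 1 = d₂ := by omega
  obtain ⟨A₁, hMN₁⟩ : ∃ A₁ : Matrix (Fin d) (Fin d) k,
      M * N₁ = f₁ • (A₁.map C : Matrix _ _ (MvPolynomial σ k)) := by
    refine exists_eq_smul_map_C h₁ hf₁0 (fun i j => hd₁' ▸ isHomogeneous_mul_apply hM hN₁h i j)
      fun i j => hcop.dvd_of_dvd_mul_left ⟨f₂ * (if i = j then 1 else 0) - (M * N₂) i j, ?_⟩
    linear_combination eMN i j
  obtain ⟨A₂, hMN₂⟩ : ∃ A₂ : Matrix (Fin d) (Fin d) k,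
      M * N₂ = f₂ • (A₂.map C : Matrix _ _ (MvPolynomial σ k)) := by
    refine exists_eq_smul_map_C h₂ hf₂0 (fun i j => hd₂' ▸ isHomogeneous_mul_apply hM hN₂h i j)
      fun i j => hcop.symm.dvd_of_dvd_mul_left ⟨f₁ * (if i = j then 1 else 0) - (M * N₁) i j, ?_⟩
    linear_combination eMN i j
  obtain ⟨B₁, hN₁M⟩ : ∃ B₁ : Matrix (Fin d) (Fin d) k,
      N₁ * M = f₁ • (B₁.map C : Matrix _ _ (MvPolynomial σ k)) := by
    refine exists_eq_smul_map_C h₁ hf₁0 (fun i j => hd₁'' ▸ isHomogeneous_mul_apply hN₁h hM i j)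
      fun i j => hcop.dvd_of_dvd_mul_left ⟨f₂ * (if i = j then 1 else 0) - (N₂ * M) i j, ?_⟩
    linear_combination eNM i j
  obtain ⟨B₂, hN₂M⟩ : ∃ B₂ : Matrix (Fin d) (Fin d) k,
      N₂ * M = f₂ • (B₂.map C : Matrix _ _ (MvPolynomial σ k)) := by
    refine exists_eq_smul_map_C h₂ hf₂0 (fun i j => hd₂'' ▸ isHomogeneous_mul_apply hN₂h hM i j)
      fun i j => hcop.symm.dvd_of_dvd_mul_left ⟨f₁ * (if i = j then 1 else 0) - (N₁ * M) i j, ?_⟩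
    linear_combination eNM i j
  -- `A₁ + A₂ = 1 = B₁ + B₂`
  have hA12 : A₁ + A₂ = 1 := by
    apply map_C_injective (σ := σ)
    change (A₁ + A₂).map C = (1 : Matrix _ _ k).map C
    rw [Matrix.map_add C (map_add C), Matrix.map_one C (map_zero C) (map_one C)]
    apply smul_cancel_of_ne_zero hf0
    rw [smul_add, ← hMadj, hadjN, Matrix.mul_add, Matrix.mul_smul, Matrix.mul_smul, hMN₁, hMN₂,
      smul_smul, smul_smul, mul_comm f₂ f₁]
  have hB12 : B₁ + B₂ = 1 := by
    apply map_C_injective (σ := σ)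
    change (B₁ + B₂).map C = (1 : Matrix _ _ k).map C
    rw [Matrix.map_add C (map_add C), Matrix.map_one C (map_zero C) (map_one C)]
    apply smul_cancel_of_ne_zero hf0
    rw [smul_add, ← hadjM, hadjN, Matrix.add_mul, Matrix.smul_mul, Matrix.smul_mul, hN₁M, hN₂M,
      smul_smul, smul_smul, mul_comm f₂ f₁]
  -- off-diagonal vanishing
  obtain ⟨hB2N1, hN2A1⟩ := offDiag_eq_zero hd₁ h₁ hf₁0 hcop hN₁h hMN₁ hN₂M
  obtain ⟨hB1N2, hN1A2⟩ := offDiag_eq_zero hd₂ h₂ hf₂0 hcop.symm hN₂h hMN₂ hN₁M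
  -- traces
  have htr : A₁.trace = B₁.trace := by
    have h1 : (M * N₁).trace = (N₁ * M).trace := Matrix.trace_mul_comm M N₁
    rw [hMN₁, hN₁M, Matrix.trace_smul, Matrix.trace_smul, smul_eq_mul, smul_eq_mul,
      trace_map_C, trace_map_C] at h1
    exact C_injective σ k (mul_left_cancel₀ hf₁0 h1)
  exact ⟨N₁, N₂, A₁, A₂, B₁, B₂, hMN₁, hMN₂, hN₁M, hN₂M, hA12, hB12, hN1A2, hN2A1, hB2N1, hB1N2,
    htr⟩

/-- `(fromBlocks 1 0 0 0).map C = fromBlocks 1 0 0 0` and `1 - fromBlocks 1 0 0 0 = fromBlocks 0 0 0 1`.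
[folklore] -/
theorem fromBlocks_one_zero_map_C {p p' : ℕ} :
    ((fromBlocks 1 0 0 0 : Matrix (Fin p ⊕ Fin p') (Fin p ⊕ Fin p') k).map C :
      Matrix (Fin p ⊕ Fin p') (Fin p ⊕ Fin p') (MvPolynomial σ k)) = fromBlocks 1 0 0 0 := by
  ext (i | i) (j | j) <;> simp [Matrix.one_apply, apply_ite C]

/-- `1 - (𝟙 ⊕ 0) = 0 ⊕ 𝟙`. [folklore] -/
theorem one_sub_fromBlocks_one_zero {p p' : ℕ} {R : Type*} [Ring R] :
    (1 : Matrix (Fin p ⊕ Fin p') (Fin p ⊕ Fin p') R) - fromBlocks 1 0 0 0 = fromBlocks 0 0 0 1 := by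
  rw [← fromBlocks_one, sub_eq_add_neg, fromBlocks_neg, fromBlocks_add]
  simp

/-- **Part 2 of [KernerVinnikov2012, Thm. 3.1] (global decomposition from `adj M ∈ (f₁, f₂)`).**
Let `f₁, f₂` be coprime forms of degrees `d₁, d₂ ≥ 1` over a field of characteristic zero and
`M` a `d × d` matrix of linear forms, `d = d₁ + d₂`, with `det M = f₁ f₂` and every entry of
`adj M` in `(f₁, f₂)`. Then there are constant invertible `A, B` with `A M B = M₁ ⊕ M₂`,
`det M_α = c_α f_α`, `c_α ≠ 0`. [cite: KernerVinnikov2012, §3, proof of Thm. 3.1, Part 2] -/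
theorem exists_blockDecomposition_of_adjugate_mem_span_pair [CharZero k] {d d₁ d₂ : ℕ}
    (hd : d = d₁ + d₂) (hd₁ : 0 < d₁) (hd₂ : 0 < d₂) {f₁ f₂ : MvPolynomial σ k}
    (h₁ : f₁.IsHomogeneous d₁) (h₂ : f₂.IsHomogeneous d₂) (hcop : IsRelPrime f₁ f₂)
    (M : Matrix (Fin d) (Fin d) (MvPolynomial σ k))
    (hM : ∀ i j, (M i j).IsHomogeneous 1) (hdet : M.det = f₁ * f₂)
    (hadj : ∀ i j, M.adjugate i j ∈ Ideal.span {f₁, f₂}) :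
    ∃ (A B : Matrix (Fin d) (Fin d) k)
      (M₁ : Matrix (Fin d₁) (Fin d₁) (MvPolynomial σ k))
      (M₂ : Matrix (Fin d₂) (Fin d₂) (MvPolynomial σ k)) (c₁ c₂ : k),
      IsUnit A ∧ IsUnit B ∧ c₁ ≠ 0 ∧ c₂ ≠ 0 ∧
        A.map C * M * B.map C = (fromBlocks M₁ 0 0 M₂).reindex
          (finSumFinEquiv.trans (finCongr hd.symm)) (finSumFinEquiv.trans (finCongr hd.symm)) ∧
        M₁.det = C c₁ * f₁ ∧ M₂.det = C c₂ * f₂ := by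
  have hf₁0 : f₁ ≠ 0 := ne_zero_of_isRelPrime_of_isHomogeneous hd₂ h₂ hcop
  have hf₂0 : f₂ ≠ 0 := ne_zero_of_isRelPrime_of_isHomogeneous hd₁ h₁ hcop.symm
  have hf0 : f₁ * f₂ ≠ 0 := mul_ne_zero hf₁0 hf₂0
  obtain ⟨N₁, N₂, A₁, A₂, B₁, B₂, hMN₁, hMN₂, hN₁M, hN₂M, hA12, hB12, hN1A2, hN2A1, hB2N1, hB1N2,
    htr⟩ := exists_projectors_of_adjugate_mem_span_pair hd hd₁ hd₂ h₁ h₂ hcop M hM hdet hadj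
  -- complementary idempotents
  have hA1A2 : A₁ * A₂ = 0 := by
    apply map_C_injective (σ := σ)
    change (A₁ * A₂).map C = (0 : Matrix _ _ k).map C
    rw [Matrix.map_mul, Matrix.map_zero C (map_zero C)]
    apply smul_cancel_of_ne_zero hf₁0
    rw [smul_zero, ← Matrix.smul_mul, ← hMN₁, Matrix.mul_assoc, hN1A2, Matrix.mul_zero]
  have hA1A1 : A₁ * A₁ = A₁ := by
    have := congrArg (A₁ * ·) hA12
    simp only [Matrix.mul_add, hA1A2, add_zero, Matrix.mul_one] at this
    exact this
  have hB1B2 : B₁ * B₂ = 0 := by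
    apply map_C_injective (σ := σ)
    change (B₁ * B₂).map C = (0 : Matrix _ _ k).map C
    rw [Matrix.map_mul, Matrix.map_zero C (map_zero C)]
    apply smul_cancel_of_ne_zero hf₂0
    rw [smul_zero, ← Matrix.mul_smul, ← hN₂M, ← Matrix.mul_assoc, hB1N2, Matrix.zero_mul]
  have hB1B1 : B₁ * B₁ = B₁ := by
    have := congrArg (B₁ * ·) hB12
    simp only [Matrix.mul_add, hB1B2, add_zero, Matrix.mul_one] at this
    exact this
  -- the cross terms `A₁ M B₂ = 0 = A₂ M B₁`
  have hK1 : (A₁.map C : Matrix _ _ (MvPolynomial σ k)) * M * (B₂.map C) = 0 := by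
    apply smul_cancel_of_ne_zero hf0
    rw [smul_zero, show (f₁ * f₂) • ((A₁.map C : Matrix _ _ (MvPolynomial σ k)) * M * (B₂.map C))
      = (f₁ • (A₁.map C : Matrix _ _ (MvPolynomial σ k))) * M * (f₂ • (B₂.map C)) by
        rw [Matrix.smul_mul, Matrix.smul_mul, Matrix.mul_smul, smul_smul],
      ← hMN₁, ← hN₂M]
    calc M * N₁ * M * (N₂ * M) = M * (N₁ * (M * N₂)) * M := by simp only [Matrix.mul_assoc]
      _ = 0 := by rw [hMN₂, Matrix.mul_smul, hN1A2, smul_zero, Matrix.mul_zero, Matrix.zero_mul]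
  have hK2 : (A₂.map C : Matrix _ _ (MvPolynomial σ k)) * M * (B₁.map C) = 0 := by
    apply smul_cancel_of_ne_zero hf0
    rw [smul_zero, show (f₁ * f₂) • ((A₂.map C : Matrix _ _ (MvPolynomial σ k)) * M * (B₁.map C))
      = (f₂ • (A₂.map C : Matrix _ _ (MvPolynomial σ k))) * M * (f₁ • (B₁.map C)) by
        rw [Matrix.smul_mul, Matrix.smul_mul, Matrix.mul_smul, smul_smul, mul_comm f₂ f₁],
      ← hMN₂, ← hN₁M]
    calc M * N₂ * M * (N₁ * M) = M * (N₂ * (M * N₁)) * M := by simp only [Matrix.mul_assoc]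
      _ = 0 := by rw [hMN₁, Matrix.mul_smul, hN2A1, smul_zero, Matrix.mul_zero, Matrix.zero_mul]
  -- normal forms of the idempotents; equal ranks via traces
  obtain ⟨q, q', hq, P, hP, hPA, hqtr⟩ := exists_conj_eq_fromBlocks_of_idempotent A₁ hA1A1
  obtain ⟨p, p', hp, S, hS, hSB, hptr⟩ := exists_conj_eq_fromBlocks_of_idempotent B₁ hB1B1
  have hpq : p = q := by
    have : (p : k) = (q : k) := by rw [hptr, hqtr, htr]
    exact_mod_cast this
  subst hpq
  have hpq' : p' = q' := by omega
  subst hpq'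
  set ε : Fin p ⊕ Fin p' ≃ Fin d := finSumFinEquiv.trans (finCongr hq) with hε
  have hSB' : S⁻¹ * B₁ * S = Matrix.reindex ε ε (fromBlocks 1 0 0 0) := hSB
  have hPdet : IsUnit P.det := (Matrix.isUnit_iff_isUnit_det _).mp hP
  have hSdet : IsUnit S.det := (Matrix.isUnit_iff_isUnit_det _).mp hS
  -- constant matrices over `k[x]`
  set Pc : Matrix (Fin d) (Fin d) (MvPolynomial σ k) := P.map C with hPc
  set Pinv : Matrix (Fin d) (Fin d) (MvPolynomial σ k) := P⁻¹.map C with hPinv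
  set Sc : Matrix (Fin d) (Fin d) (MvPolynomial σ k) := S.map C with hSc
  set Sinv : Matrix (Fin d) (Fin d) (MvPolynomial σ k) := S⁻¹.map C with hSinv
  have hPinvPc : Pinv * Pc = 1 := by
    rw [hPinv, hPc, ← Matrix.map_mul, Matrix.nonsing_inv_mul _ hPdet,
      Matrix.map_one C (map_zero C) (map_one C)]
  have hPcPinv : Pc * Pinv = 1 := by
    rw [hPinv, hPc, ← Matrix.map_mul, Matrix.mul_nonsing_inv _ hPdet,
      Matrix.map_one C (map_zero C) (map_one C)]
  have hSinvSc : Sinv * Sc = 1 := by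
    rw [hSinv, hSc, ← Matrix.map_mul, Matrix.nonsing_inv_mul _ hSdet,
      Matrix.map_one C (map_zero C) (map_one C)]
  have hScSinv : Sc * Sinv = 1 := by
    rw [hSinv, hSc, ← Matrix.map_mul, Matrix.mul_nonsing_inv _ hSdet,
      Matrix.map_one C (map_zero C) (map_one C)]
  -- the projector `F = 𝟙_p ⊕ 0` over `k[x]` and its conjugates
  set F : Matrix (Fin p ⊕ Fin p') (Fin p ⊕ Fin p') (MvPolynomial σ k) := fromBlocks 1 0 0 0
    with hF
  have hrF_A : Pinv * (A₁.map C) * Pc = Matrix.reindex ε ε F := by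
    have := congrArg (fun X : Matrix (Fin d) (Fin d) k =>
      (X.map C : Matrix _ _ (MvPolynomial σ k))) hPA
    simp only [Matrix.map_mul] at this
    rw [hPinv, hPc, this, hF, ← fromBlocks_one_zero_map_C]
    rfl
  have hrF_B : Sinv * (B₁.map C) * Sc = Matrix.reindex ε ε F := by
    have := congrArg (fun X : Matrix (Fin d) (Fin d) k =>
      (X.map C : Matrix _ _ (MvPolynomial σ k))) hSB'
    simp only [Matrix.map_mul] at this
    rw [hSinv, hSc, this, hF, ← fromBlocks_one_zero_map_C]
    rfl
  have hA₂c : (A₂.map C : Matrix _ _ (MvPolynomial σ k)) = 1 - A₁.map C := by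
    rw [eq_sub_iff_add_eq, ← Matrix.map_add C (map_add C), add_comm, hA12,
      Matrix.map_one C (map_zero C) (map_one C)]
  have hB₂c : (B₂.map C : Matrix _ _ (MvPolynomial σ k)) = 1 - B₁.map C := by
    rw [eq_sub_iff_add_eq, ← Matrix.map_add C (map_add C), add_comm, hB12,
      Matrix.map_one C (map_zero C) (map_one C)]
  have hreindex_one_sub : Matrix.reindex ε ε (1 - F) = 1 - Matrix.reindex ε ε F := by
    ext i j
    simp [Matrix.one_apply]
  have hrG_A : Pinv * (A₂.map C) * Pc = Matrix.reindex ε ε (1 - F) := by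
    rw [hA₂c, Matrix.mul_sub, Matrix.sub_mul, Matrix.mul_one, hPinvPc, hrF_A, hreindex_one_sub]
  have hrG_B : Sinv * (B₂.map C) * Sc = Matrix.reindex ε ε (1 - F) := by
    rw [hB₂c, Matrix.mul_sub, Matrix.sub_mul, Matrix.mul_one, hSinvSc, hrF_B, hreindex_one_sub]
  -- the transformed matrix and its `Sum`-indexed version
  set M' : Matrix (Fin d) (Fin d) (MvPolynomial σ k) := Pinv * M * Sc with hM'
  set M'' : Matrix (Fin p ⊕ Fin p') (Fin p ⊕ Fin p') (MvPolynomial σ k) := M'.submatrix ε ε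
    with hM''
  have hsubF : ∀ X : Matrix (Fin p ⊕ Fin p') (Fin p ⊕ Fin p') (MvPolynomial σ k),
      (Matrix.reindex ε ε X).submatrix ε ε = X := fun X => by
    simp [Matrix.reindex_apply, Matrix.submatrix_submatrix]
  have hoff1 : F * M'' * (1 - F) = 0 := by
    have h1 : Matrix.reindex ε ε F * M' * Matrix.reindex ε ε (1 - F) = 0 := by
      rw [← hrF_A, ← hrG_B, hM']
      calc Pinv * A₁.map C * Pc * (Pinv * M * Sc) * (Sinv * B₂.map C * Sc)
          = Pinv * ((A₁.map C) * ((Pc * Pinv) * M * (Sc * Sinv)) * (B₂.map C)) * Sc := by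
            simp only [Matrix.mul_assoc]
        _ = 0 := by
            rw [hPcPinv, hScSinv, Matrix.one_mul, Matrix.mul_one, hK1, Matrix.mul_zero,
              Matrix.zero_mul]
    have := congrArg (fun X : Matrix (Fin d) (Fin d) (MvPolynomial σ k) => X.submatrix ε ε) h1
    simp only [Matrix.submatrix_zero, Pi.zero_apply] at this
    rw [← Matrix.submatrix_mul_equiv _ _ ε ε ε, ← Matrix.submatrix_mul_equiv _ _ ε ε ε,
      hsubF, hsubF] at this
    exact this
  have hoff2 : (1 - F) * M'' * F = 0 := by
    have h1 : Matrix.reindex ε ε (1 - F) * M' * Matrix.reindex ε ε F = 0 := by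
      rw [← hrG_A, ← hrF_B, hM']
      calc Pinv * A₂.map C * Pc * (Pinv * M * Sc) * (Sinv * B₁.map C * Sc)
          = Pinv * ((A₂.map C) * ((Pc * Pinv) * M * (Sc * Sinv)) * (B₁.map C)) * Sc := by
            simp only [Matrix.mul_assoc]
        _ = 0 := by
            rw [hPcPinv, hScSinv, Matrix.one_mul, Matrix.mul_one, hK2, Matrix.mul_zero,
              Matrix.zero_mul]
    have := congrArg (fun X : Matrix (Fin d) (Fin d) (MvPolynomial σ k) => X.submatrix ε ε) h1
    simp only [Matrix.submatrix_zero, Pi.zero_apply] at this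
    rw [← Matrix.submatrix_mul_equiv _ _ ε ε ε, ← Matrix.submatrix_mul_equiv _ _ ε ε ε,
      hsubF, hsubF] at this
    exact this
  -- hence `M''` is block diagonal
  set X₁₁ := M''.toBlocks₁₁ with hX₁₁
  set X₂₂ := M''.toBlocks₂₂ with hX₂₂
  have hX : M'' = fromBlocks X₁₁ 0 0 X₂₂ := by
    have z12 : Matrix.toBlocks₁₂ (0 : Matrix (Fin p ⊕ Fin p') (Fin p ⊕ Fin p') (MvPolynomial σ k))
        = 0 := rfl
    have z21 : Matrix.toBlocks₂₁ (0 : Matrix (Fin p ⊕ Fin p') (Fin p ⊕ Fin p') (MvPolynomial σ k))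
        = 0 := rfl
    have h12 : M''.toBlocks₁₂ = 0 := by
      have := congrArg Matrix.toBlocks₁₂ hoff1
      rw [← fromBlocks_toBlocks M'', one_sub_fromBlocks_one_zero, hF, fromBlocks_multiply,
        fromBlocks_multiply, z12] at this
      simpa using this
    have h21 : M''.toBlocks₂₁ = 0 := by
      have := congrArg Matrix.toBlocks₂₁ hoff2
      rw [← fromBlocks_toBlocks M'', one_sub_fromBlocks_one_zero, hF, fromBlocks_multiply,
        fromBlocks_multiply, z21] at this
      simpa using this
    conv_lhs => rw [← fromBlocks_toBlocks M'', h12, h21]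
  -- `M'' Ñ₁ = f₁ F`, `M'' Ñ₂ = f₂ (1 - F)`: determinants of the blocks divide `f_α ^ size`
  have hMN₁' : M' * (Sinv * N₁ * Pc) = f₁ • Matrix.reindex ε ε F := by
    rw [hM', ← hrF_A]
    calc Pinv * M * Sc * (Sinv * N₁ * Pc) = Pinv * (M * ((Sc * Sinv) * N₁)) * Pc := by
          simp only [Matrix.mul_assoc]
      _ = f₁ • (Pinv * A₁.map C * Pc) := by
          rw [hScSinv, Matrix.one_mul, hMN₁, Matrix.mul_smul, Matrix.smul_mul, Matrix.mul_assoc]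
  have hMN₂' : M' * (Sinv * N₂ * Pc) = f₂ • Matrix.reindex ε ε (1 - F) := by
    rw [hM', ← hrG_A]
    calc Pinv * M * Sc * (Sinv * N₂ * Pc) = Pinv * (M * ((Sc * Sinv) * N₂)) * Pc := by
          simp only [Matrix.mul_assoc]
      _ = f₂ • (Pinv * A₂.map C * Pc) := by
          rw [hScSinv, Matrix.one_mul, hMN₂, Matrix.mul_smul, Matrix.smul_mul, Matrix.mul_assoc]
  have hdet₁ : X₁₁.det * ((Sinv * N₁ * Pc).submatrix ε ε).toBlocks₁₁.det = f₁ ^ p := by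
    have : M'' * (Sinv * N₁ * Pc).submatrix ε ε = f₁ • F := by
      rw [hM'', Matrix.submatrix_mul_equiv M' _ ε ε ε, hMN₁']
      ext i j
      simp
    rw [hX, ← fromBlocks_toBlocks ((Sinv * N₁ * Pc).submatrix ε ε), fromBlocks_multiply, hF,
      fromBlocks_smul] at this
    have h11 := congrArg Matrix.toBlocks₁₁ this
    simp only [toBlocks_fromBlocks₁₁, Matrix.zero_mul, add_zero] at h11
    rw [← det_mul, h11, det_smul, det_one, mul_one, Fintype.card_fin]
  have hdet₂ : X₂₂.det * ((Sinv * N₂ * Pc).submatrix ε ε).toBlocks₂₂.det = f₂ ^ p' := by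
    have : M'' * (Sinv * N₂ * Pc).submatrix ε ε = f₂ • (1 - F) := by
      rw [hM'', Matrix.submatrix_mul_equiv M' _ ε ε ε, hMN₂']
      ext i j
      simp [Matrix.one_apply]
    rw [hX, ← fromBlocks_toBlocks ((Sinv * N₂ * Pc).submatrix ε ε), fromBlocks_multiply,
      one_sub_fromBlocks_one_zero, fromBlocks_smul] at this
    have h22 := congrArg Matrix.toBlocks₂₂ this
    simp only [toBlocks_fromBlocks₂₂, Matrix.zero_mul, zero_add] at h22
    rw [← det_mul, h22, det_smul, det_one, mul_one, Fintype.card_fin]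
  -- `det X₁₁ det X₂₂ = c f₁ f₂` with `c` a nonzero constant
  have hdetM'' : X₁₁.det * X₂₂.det = C ((P⁻¹).det * S.det) * (f₁ * f₂) := by
    have h1 : M''.det = M'.det := Matrix.det_submatrix_equiv_self ε M'
    rw [hX, det_fromBlocks_zero₂₁] at h1
    rw [h1, hM', det_mul, det_mul, hPinv, hSc, hdet]
    have e1 : (P⁻¹.map C : Matrix _ _ (MvPolynomial σ k)).det = C (P⁻¹).det := by
      rw [RingHom.map_det, RingHom.mapMatrix_apply]
    have e2 : (S.map C : Matrix _ _ (MvPolynomial σ k)).det = C S.det := by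
      rw [RingHom.map_det, RingHom.mapMatrix_apply]
    rw [e1, e2, map_mul]
    ring
  have hc0 : (P⁻¹).det * S.det ≠ 0 :=
    mul_ne_zero (Matrix.isUnit_det_of_right_inverse (Matrix.nonsing_inv_mul P hPdet)).ne_zero
      hSdet.ne_zero
  -- coprimality bookkeeping: `det X₁₁ = c₁ f₁`, `det X₂₂ = c₂ f₂`
  have hrel₁ : IsRelPrime X₁₁.det f₂ := by
    have : IsRelPrime (f₁ ^ p) f₂ := hcop.pow_left
    rw [← hdet₁] at this
    exact this.of_mul_left_left
  have hrel₂ : IsRelPrime X₂₂.det f₁ := by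
    have : IsRelPrime (f₂ ^ p') f₁ := hcop.symm.pow_left
    rw [← hdet₂] at this
    exact this.of_mul_left_left
  obtain ⟨g₁, hg₁⟩ : f₁ ∣ X₁₁.det :=
    hrel₂.symm.dvd_of_dvd_mul_right ⟨C ((P⁻¹).det * S.det) * f₂, by rw [hdetM'']; ring⟩
  obtain ⟨g₂, hg₂⟩ : f₂ ∣ X₂₂.det :=
    hrel₁.symm.dvd_of_dvd_mul_left ⟨C ((P⁻¹).det * S.det) * f₁, by rw [hdetM'']; ring⟩
  have hg : g₁ * g₂ = C ((P⁻¹).det * S.det) := by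
    apply mul_left_cancel₀ hf0
    have := hdetM''
    rw [hg₁, hg₂] at this
    linear_combination this
  have hg₁u : IsUnit g₁ := IsUnit.of_mul_eq_one (g₂ * C ((P⁻¹).det * S.det)⁻¹) (by
    rw [← mul_assoc, hg, ← map_mul, mul_inv_cancel₀ hc0, map_one])
  have hg₂u : IsUnit g₂ := IsUnit.of_mul_eq_one (g₁ * C ((P⁻¹).det * S.det)⁻¹) (by
    rw [← mul_assoc, mul_comm g₂ g₁, hg, ← map_mul, mul_inv_cancel₀ hc0, map_one])
  obtain ⟨c₁, hc₁, hgc₁⟩ := (MvPolynomial.isUnit_iff_eq_C_of_isReduced (P := g₁)).mp hg₁u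
  obtain ⟨c₂, hc₂, hgc₂⟩ := (MvPolynomial.isUnit_iff_eq_C_of_isReduced (P := g₂)).mp hg₂u
  -- block sizes: `p = d₁`, `p' = d₂`
  have hM'h : ∀ i j, (M' i j).IsHomogeneous 1 := by
    intro i j
    have := isHomogeneous_mul_apply (isHomogeneous_mul_apply (isHomogeneous_map_C_apply P⁻¹) hM)
      (isHomogeneous_map_C_apply S) i j
    simpa using this
  have hpd₁ : p = d₁ := by
    have hh1 : X₁₁.det.IsHomogeneous p := by
      have := isHomogeneous_det_of_linear (X := X₁₁) (fun i j => hM'h _ _)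
      rwa [Fintype.card_fin] at this
    have hh2 : X₁₁.det.IsHomogeneous d₁ := by
      rw [hg₁, hgc₁]
      simpa using h₁.mul (isHomogeneous_C σ c₁)
    refine hh1.inj_right hh2 ?_
    rw [hg₁, hgc₁]
    exact mul_ne_zero hf₁0 (by simpa using hc₁.ne_zero)
  subst hpd₁
  have hpd₂ : p' = d₂ := by omega
  subst hpd₂
  -- assemble
  refine ⟨P⁻¹, S, X₁₁, X₂₂, c₁, c₂, IsUnit.of_mul_eq_one P (Matrix.nonsing_inv_mul P hPdet), hS,
    hc₁.ne_zero, hc₂.ne_zero, ?_, ?_, ?_⟩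
  · change M' = _
    rw [show finSumFinEquiv.trans (finCongr hd.symm) = ε from rfl, ← hX, hM'']
    simp [Matrix.reindex_apply, Matrix.submatrix_submatrix]
  · rw [hg₁, hgc₁, mul_comm]
  · rw [hg₂, hgc₂, mul_comm]

end part2

end Literature.AlgebraicGeometry.DeterminantalHypersurfaces
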